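import Summits.QuantumFields.BalabanUV.Beta.FP.PerfectObjectsT
import Summits.QuantumFields.BalabanUV.Beta.GAN24.MultiplierDictionary

/-!
# `BalabanUV.Beta.FP.ConvergenceJMMultiplier` — road «FP» for binder row D1, leaf X1m (MULTIPLIER–MULTIPLIER BLOCK, unconditional):
# the mm block of the (j, m)-resolvent `KTot (Lc^(j+m)) (Lc^j)` is an2's `wΦ^{(Lc^{j+m})}` read at the `Lc^m`-coarse points of the step-`j`
# lattice; in the adopted units `(Lc^j, Lc^{4j})` (d = 3) it is `(2/Lc^{8m})·Δ_{j+m}` (gan24's `MultiplierDictionary.wΦ_eq_deltaZ` BY NAME), hence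
# `j`-UNIFORMLY decaying, CAUCHY at rate `Lc⁻²`, and ENTRYWISE CONVERGENT to the mm block of the perfect resolvent `KPerf … m`

HONEST FRAMING (cell contract, verbatim): «discharging `BetaPertH` makes Bałaban's UV stability UNCONDITIONAL — a real constructive-QFT
result; it is NOT the continuum limit and NOT the Clay problem.»  THIS MODULE DISCHARGES NOTHING of the wall: it proves ONE LEG BLOCK (mm) of ONE
convergence hypothesis (X1m: entrywise convergence of the unit-rescaled (j, m)-families, `HOME/beta/skeletons/D1-b2b-balaban-beta-d1-p3.md` §3 X1 /
claim table `HOME/b2b-balaban-beta-d1-p3/LEAVES-FP.md` row X1m-der, sub-row X1m-mm, unit `b2b-balaban-beta-d1-formalise-leaf-06`) of road FP, by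
composing LANDED theorems BY NAME: `FP.PerfectObjects.KTot` (p207092), `OneStepResolventKernel.KInv_inr_inr_coarse/KInv_inr_off` (an2),
`GAN24.MultiplierDictionary.wΦ_eq_deltaZ` (gan24-leaf-18), `GAN24.TransverseDictionary.mmPart/deltaZ_abs_le_l1/deltaZ_step_abs_le_l1/exp_coarse`,
`GAN24.CombesThomas.decayCauchy_of_stepDecay`, `HessKerDressedLimit.tendsto_limMKerOf_of_decays`.  The field–field / field–multiplier blocks of X1m are
NOT touched (they are road P1's leaves L08–L11 of row G-an2-4 / X1m-der proper).  «not in print; our proof».  NOT BetaPertH, NOT continuum, NOT Clay.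

ABSOLUTE RULE (cell, verbatim): «No internally-minted statement may enter as a cited fact. Every hypothesis is either kernel-proved in this package or a
verbatim quotation of a PUBLISHED theorem with page reference.»  Nothing is cited, no `def … : Prop`, no binder instantiated at a value; every
statement below is a theorem about the cell's typed objects with 0 hypotheses beyond `Lc ≥ 2` (for `θ = Lc⁻² < 1`).

CONTENT (all [folklore] / [our object]; `d` general in §1, `d = 3` from §2 on).
* §1 `proj_pow_add_smul_eq_zero_iff` (`proj (Lc^(j+m)) (Lc^j • x′) = 0 ↔ proj (Lc^m) x′ = 0`), `pow_smul_eq_pow_add_smul_quo`, **`KTot_inr_inr`**: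
  `KTot (Lc^(j+m)) (Lc^j) x′ y′ (inr κ) (inr l) = [proj (Lc^m) x′ = 0 ∧ proj (Lc^m) y′ = 0] · wΦ^{(Lc^{j+m})} κ l (quo (Lc^m) x′ − quo (Lc^m) y′)`
  (the `m = 1` member is `TransverseDictionary.KInvStep_inr_inr` by `KInvStep_eq_KTot`); `unitK_KTot_inr_inr`.
* §2 (d = 3) `units_cancel` (`smStep 3 Lc j ^ 2 · 2·((Lc^(j+m))^8)⁻¹ = 2·((Lc^m)^8)⁻¹` — `j`-FREE because `2(d+1) = d+5` at `d = 3`), **`mmJM_apply`** (closed form `(2/Lc^{8m}) · deltaZ Lc (j+m) (quo x′ − quo y′, κ) (0, l)` at coarse points, `0` elsewhere and off the mm legs).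
* §3 (the mm family `mmJM := j ↦ mmPart (D_j · KTot (Lc^(j+m)) (Lc^j) · D_j)`, written out — no `def`) **`mmJM_uniformDecays`**
  (`UniformDecays mmJM ((2/Lc^{8m})·c166Z 3) (kappaZ 3/Lc^m)`), **`mmJM_stepDecays`** (one-step differences with constant
  `(2/Lc^{8m})·theta166Z 3·(Lc⁻²)^m · (Lc⁻²)^j`), **`mmJM_decayCauchy`** (`Lc ≥ 2`), `mmJM_binders` (∃-packaged).
* §4 **`tendsto_mm_KTot_KPerf`**: for `Lc ≥ 2` every mm entry of the unit-rescaled (j, m)-family converges, as `j → ∞`, to the corresponding mm entry of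
  `KPerf Lc (sfStep Lc) (smStep 3 Lc) m` — the mm quarter of the X1m hypothesis (`hKall`/`hconv` of `FP/StationarityK`), discharged; `decays_mm_KPerf` (the limit's mm
  block inherits the uniform decay).
-/

namespace Summit.QuantumFields.BalabanUV.Beta.FP.ConvergenceJMMultiplier

open Filter Topology Finset
open scoped BigOperators
open Literature.Probability.LatticeModels (Torus.proj Torus.proj_apply)
open Literature.MathematicalPhysics.QuantumFieldTheory
open Literature.MathematicalPhysics.QuantumFieldTheory.Balaban1983to89
open Literature.MathematicalPhysics.QuantumFieldTheory.Balaban1983to89.Beta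
open LatticeForm (quo)
open B12Sec2to5 (l1 l1_nonneg)
open ExpKernelCalculus (MKer Decays)
open OneStepResolventKernel (Fib KInv KInv_inr_inr_coarse KInv_inr_off)
open OneStepKernelFamily (dec legSet legPt legW)
open KernelSpecInstance (wΦ)
open B4Sect5Exhaustion (K)
open HessKerDressedLimit (limMKerOf limMKerOf_apply tendsto_limMKerOf_of_decays decays_limMKerOf)
open Summit.QuantumFields.BalabanUV.Beta.HessKerDressedUnits (unitK legScale unitK_apply legScale_inr legScale_inl)
open Summit.QuantumFields.BalabanUV.Beta.GAN24.ScaleNesting (proj_eq_zero_iff)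
open Summit.QuantumFields.BalabanUV.Beta.GAN24.CombesThomas (UniformDecays DecayCauchy smStep sfStep decayCauchy_of_stepDecay)
open Summit.QuantumFields.BalabanUV.Beta.GAN24.DirichletExhaustionDeltaZ (deltaZ c166Z theta166Z kappaZ kappaZ_pos)
open Summit.QuantumFields.BalabanUV.Beta.GAN24.TransverseDictionary (mmPart mmPart_inr_inr mmPart_inl_left mmPart_inl_right mmPart_sub
  deltaZ_abs_le_l1 deltaZ_step_abs_le_l1 exp_coarse theta_lt_one)
open Summit.QuantumFields.BalabanUV.Beta.GAN24.MultiplierDictionary (wΦ_eq_deltaZ)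
open Summit.QuantumFields.BalabanUV.Beta.FP.PerfectObjects (KTot KTot_def)
open Summit.QuantumFields.BalabanUV.Beta.FP.PerfectObjectsT (KPerf)

noncomputable section

/-! ## §1 The multiplier–multiplier block of the (j, m)-resolvent -/

section General

variable {d : ℕ} {Lc : ℕ} [NeZero Lc]

/-- [folklore] THE `Lc^m`-COARSE POINTS OF THE STEP-`j` LATTICE: `Lc^j • x′` lies on the `Lc^(j+m)`-sublattice iff `x′` lies on the `Lc^m`-sublattice. -/
theorem proj_pow_add_smul_eq_zero_iff (j m : ℕ) (x' : Fin (d + 1) → ℤ) :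
    Torus.proj (Lc ^ (j + m)) (((Lc ^ j : ℕ) : ℤ) • x') = 0 ↔ Torus.proj (Lc ^ m) x' = 0 := by
  have hL : ((Lc ^ j : ℕ) : ℤ) ≠ 0 := by exact_mod_cast pow_ne_zero _ (NeZero.ne Lc)
  simp only [proj_eq_zero_iff, Pi.smul_apply, smul_eq_mul]
  refine forall_congr' fun i => ?_
  rw [show ((Lc ^ (j + m) : ℕ) : ℤ) = ((Lc ^ j : ℕ) : ℤ) * ((Lc ^ m : ℕ) : ℤ) by push_cast; ring]
  exact mul_dvd_mul_iff_left hL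

/-- [folklore] At an `Lc^m`-coarse point `x′` of the step-`j` lattice, `Lc^j • x′ = Lc^(j+m) • quo (Lc^m) x′`. -/
theorem pow_smul_eq_pow_add_smul_quo (j m : ℕ) {x' : Fin (d + 1) → ℤ} (hx : Torus.proj (Lc ^ m) x' = 0) :
    ((Lc ^ j : ℕ) : ℤ) • x' = ((Lc ^ (j + m) : ℕ) : ℤ) • quo (Lc ^ m) x' := by
  conv_lhs => rw [Summit.QuantumFields.BalabanUV.Beta.GAN24.CombesThomasFibre.eq_zsmul_quo_of_proj_eq_zero hx]
  rw [smul_smul]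
  push_cast
  ring_nf

/-- **THE mm BLOCK OF THE (j, m)-RESOLVENT**: at the `Lc^m`-coarse points of the step-`j` lattice it is an2's multiplier response `wΦ` of blocking
`Lc^(j+m)` read at the `Lc^m`-block-index difference; elsewhere `0`.  (`m = 1`: `TransverseDictionary.KInvStep_inr_inr`.) [our object] -/
theorem KTot_inr_inr (j m : ℕ) (κ l : Fin (d + 1)) (x' y' : Fin (d + 1) → ℤ) :
    KTot (d := d) (Lc ^ (j + m)) (Lc ^ j) x' y' (Sum.inr κ) (Sum.inr l) =
      if Torus.proj (Lc ^ m) x' = 0 ∧ Torus.proj (Lc ^ m) y' = 0 then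
        wΦ (N := Lc ^ (j + m)) κ l (quo (Lc ^ m) x' - quo (Lc ^ m) y') else 0 := by
  simp only [KTot_def, dec, legSet, legW, legPt, Finset.sum_singleton, one_mul]
  by_cases hx : Torus.proj (Lc ^ m) x' = 0
  · by_cases hy : Torus.proj (Lc ^ m) y' = 0
    · rw [if_pos ⟨hx, hy⟩, pow_smul_eq_pow_add_smul_quo j m hx, pow_smul_eq_pow_add_smul_quo j m hy, KInv_inr_inr_coarse]
    · rw [if_neg (fun h => hy h.2)]
      simp only [KInv]
      rw [if_neg]
      intro h
      exact hy ((proj_pow_add_smul_eq_zero_iff j m y').1 h.2)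
  · rw [if_neg (fun h => hx h.1)]
    exact KInv_inr_off (N := Lc ^ (j + m)) (by rwa [Ne, proj_pow_add_smul_eq_zero_iff]) κ _ _

/-- [our object] The mm block of the UNIT-RESCALED (j, m)-resolvent: the multiplier unit squared times the mm block. -/
theorem unitK_KTot_inr_inr (sf sm : ℕ → ℝ) (j m : ℕ) (κ l : Fin (d + 1)) (x' y' : Fin (d + 1) → ℤ) :
    unitK (sf j) (sm j) (KTot (d := d) (Lc ^ (j + m)) (Lc ^ j)) x' y' (Sum.inr κ) (Sum.inr l) =
      sm j ^ 2 * (if Torus.proj (Lc ^ m) x' = 0 ∧ Torus.proj (Lc ^ m) y' = 0 then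
        wΦ (N := Lc ^ (j + m)) κ l (quo (Lc ^ m) x' - quo (Lc ^ m) y') else 0) := by
  rw [unitK_apply, KTot_inr_inr, legScale_inr, legScale_inr]
  ring

end General

/-! ## §2 `d = 3`, adopted units `(Lc^j, Lc^{4j})`: the closed form through Bałaban's `Δ_{j+m}` (gan24's mm dictionary BY NAME) -/

section Three

variable {Lc : ℕ} [NeZero Lc]

/-- [folklore] THE UNITS CANCEL, `j`-FREE: `s_m(j)² · 2·((Lc^(j+m))^8)⁻¹ = 2·((Lc^m)^8)⁻¹` (`s_m(j) = Lc^{4j}`; `2(d+1) = d+5` at `d = 3`). -/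
theorem units_cancel (j m : ℕ) :
    smStep 3 Lc j ^ 2 * (2 * ((((Lc : ℝ) ^ (j + m)) ^ (3 + 5))⁻¹)) = 2 * ((((Lc : ℝ) ^ m) ^ 8)⁻¹) := by
  have hL : (Lc : ℝ) ≠ 0 := Nat.cast_ne_zero.2 (NeZero.ne Lc)
  have ha : (Lc : ℝ) ^ j ≠ 0 := pow_ne_zero _ hL
  have hb : (Lc : ℝ) ^ m ≠ 0 := pow_ne_zero _ hL
  rw [smStep, pow_mul, pow_add]
  field_simp
  ring

/-- **THE CLOSED FORM**: the mm entries of the unit-rescaled (j, m)-resolvent at `Lc^m`-coarse points ARE `(2/Lc^{8m}) · Δ_{j+m}` of Bałaban's (1.66) layer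
(gan24's `deltaZ`), read at the `Lc^m`-block indices — `MultiplierDictionary.wΦ_eq_deltaZ` at `k := j + m`, BY NAME. [our object] -/
theorem mmJM_apply (m j : ℕ) (κ l : Fin (3 + 1)) (x' y' : Fin (3 + 1) → ℤ) :
    mmPart (unitK (sfStep Lc j) (smStep 3 Lc j) (KTot (d := 3) (Lc ^ (j + m)) (Lc ^ j))) x' y' (Sum.inr κ) (Sum.inr l) =
      if Torus.proj (Lc ^ m) x' = 0 ∧ Torus.proj (Lc ^ m) y' = 0 then
        (2 * ((((Lc : ℝ) ^ m) ^ 8)⁻¹)) * deltaZ Lc (j + m) (quo (Lc ^ m) x' - quo (Lc ^ m) y', κ) (0, l) else 0 := by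
  rw [mmPart_inr_inr, unitK_KTot_inr_inr]
  split_ifs with h
  · rw [wΦ_eq_deltaZ Lc (j + m), ← mul_assoc, units_cancel]
  · rw [mul_zero]

end Three

/-! ## §3 Uniform decay, one-step differences, Cauchy rate of the mm family -/

section Decay

variable {Lc : ℕ} [NeZero Lc]

/-- [folklore] Rate bookkeeping at modulus `Lc^m`: `e^{−κ₀|u−v|₁} = e^{−(κ₀/Lc^m)|x′−y′|₁}` at `Lc^m`-coarse points. -/
theorem exp_coarse_pow (m : ℕ) {x' y' : Fin (3 + 1) → ℤ} (hx : Torus.proj (Lc ^ m) x' = 0) (hy : Torus.proj (Lc ^ m) y' = 0) (κ₀ : ℝ) :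
    Real.exp (-κ₀ * l1 (quo (Lc ^ m) x' - quo (Lc ^ m) y')) = Real.exp (-(κ₀ / (Lc : ℝ) ^ m) * l1 (x' - y')) := by
  rw [exp_coarse (Lc := Lc ^ m) hx hy κ₀, Nat.cast_pow]

/-- **`j`-UNIFORM DECAY OF THE mm FAMILY** `j ↦ mmPart (D_j · KTot (Lc^(j+m)) (Lc^j) · D_j)`: constant `(2/Lc^{8m})·c166Z 3`, rate `kappaZ 3 / Lc^m` — Bałaban's (1.66) constant, the (j, m)
system's correlation length `Lc^m` in step-`j` units in the rate. [our object] -/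
theorem mmJM_uniformDecays (m : ℕ) :
    UniformDecays (fun j => mmPart (unitK (sfStep Lc j) (smStep 3 Lc j) (KTot (d := 3) (Lc ^ (j + m)) (Lc ^ j))))
      (2 * ((((Lc : ℝ) ^ m) ^ 8)⁻¹) * c166Z 3) (kappaZ 3 / (Lc : ℝ) ^ m) := by
  intro j x' y' a b
  beta_reduce
  have hC : 0 ≤ 2 * ((((Lc : ℝ) ^ m) ^ 8)⁻¹) * c166Z 3 * Real.exp (-(kappaZ 3 / (Lc : ℝ) ^ m) * l1 (x' - y')) := by
    have := B5Symbol166Strip.MG_pos (3 + 1); unfold c166Z; positivity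
  cases a with
  | inl κ => simpa using hC
  | inr κ =>
    cases b with
    | inl l => simpa using hC
    | inr l =>
      rw [mmJM_apply]
      split_ifs with h
      · have h2 : (0 : ℝ) ≤ 2 * ((((Lc : ℝ) ^ m) ^ 8)⁻¹) := by positivity
        rw [abs_mul, abs_of_nonneg h2, ← exp_coarse_pow m h.1 h.2, mul_assoc (2 * ((((Lc : ℝ) ^ m) ^ 8)⁻¹)) (c166Z 3)]
        refine mul_le_mul_of_nonneg_left ?_ h2
        have := deltaZ_abs_le_l1 Lc (j + m) (quo (Lc ^ m) x' - quo (Lc ^ m) y', κ) ((0 : Fin (3 + 1) → ℤ), l)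
        simpa using this
      · simpa using hC

/-- **ONE-STEP DIFFERENCES OF THE mm FAMILY** decay with the small constant `(2/Lc^{8m})·theta166Z 3·(Lc⁻²)^m · (Lc⁻²)^j` at rate `kappaZ 3/Lc^m` — Bałaban's
η-rate `θ = Lc⁻²` of (1.66) between the levels `j + m` and `j + m + 1`. [our object] -/
theorem mmJM_stepDecays (m j : ℕ) :
    Decays (mmPart (unitK (sfStep Lc (j + 1)) (smStep 3 Lc (j + 1)) (KTot (d := 3) (Lc ^ (j + 1 + m)) (Lc ^ (j + 1)))) -
        mmPart (unitK (sfStep Lc j) (smStep 3 Lc j) (KTot (d := 3) (Lc ^ (j + m)) (Lc ^ j))))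
      (2 * ((((Lc : ℝ) ^ m) ^ 8)⁻¹) * theta166Z 3 * (((Lc : ℝ) ^ 2)⁻¹) ^ m * (((Lc : ℝ) ^ 2)⁻¹) ^ j) (kappaZ 3 / (Lc : ℝ) ^ m) := by
  intro x' y' a b
  have hC : 0 ≤ 2 * ((((Lc : ℝ) ^ m) ^ 8)⁻¹) * theta166Z 3 * (((Lc : ℝ) ^ 2)⁻¹) ^ m * (((Lc : ℝ) ^ 2)⁻¹) ^ j *
      Real.exp (-(kappaZ 3 / (Lc : ℝ) ^ m) * l1 (x' - y')) := by
    have := T4Rate166StripDirect.C166_pos (3 + 1); unfold theta166Z; positivity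
  rw [HessKerDressedLimit.mker_sub_apply]
  cases a with
  | inl κ => simpa using hC
  | inr κ =>
    cases b with
    | inl l => simpa using hC
    | inr l =>
      rw [mmJM_apply, mmJM_apply]
      split_ifs with h
      · have h2 : (0 : ℝ) ≤ 2 * ((((Lc : ℝ) ^ m) ^ 8)⁻¹) := by positivity
        rw [Nat.add_right_comm j 1 m, ← mul_sub, abs_mul, abs_of_nonneg h2, ← exp_coarse_pow m h.1 h.2]
        have hstep := deltaZ_step_abs_le_l1 Lc (j + m) (quo (Lc ^ m) x' - quo (Lc ^ m) y', κ) ((0 : Fin (3 + 1) → ℤ), l)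
        have hsplit : (((Lc : ℝ) ^ 2)⁻¹) ^ (j + m) = (((Lc : ℝ) ^ 2)⁻¹) ^ m * (((Lc : ℝ) ^ 2)⁻¹) ^ j := by rw [pow_add, mul_comm]
        rw [hsplit] at hstep
        calc 2 * ((((Lc : ℝ) ^ m) ^ 8)⁻¹) *
              |deltaZ Lc (j + m + 1) (quo (Lc ^ m) x' - quo (Lc ^ m) y', κ) (0, l) - deltaZ Lc (j + m) (quo (Lc ^ m) x' - quo (Lc ^ m) y', κ) (0, l)|
            ≤ 2 * ((((Lc : ℝ) ^ m) ^ 8)⁻¹) *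
              (theta166Z 3 * ((((Lc : ℝ) ^ 2)⁻¹) ^ m * (((Lc : ℝ) ^ 2)⁻¹) ^ j) *
                Real.exp (-(kappaZ 3) * l1 (quo (Lc ^ m) x' - quo (Lc ^ m) y'))) :=
              mul_le_mul_of_nonneg_left (by simpa using hstep) h2
          _ = _ := by ring
      · simpa using hC

/-- **THE mm FAMILY IS CAUCHY IN THE EXPONENTIALLY WEIGHTED NORM** (`Lc ≥ 2`): `DecayCauchy mmJM (c_m/(1 − Lc⁻²)) Lc⁻² (kappaZ 3/Lc^m)` with
`c_m = (2/Lc^{8m})·theta166Z 3·(Lc⁻²)^m` (`CombesThomas.decayCauchy_of_stepDecay` BY NAME). [our object] -/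
theorem mmJM_decayCauchy (hLc : 2 ≤ Lc) (m : ℕ) :
    DecayCauchy (fun j => mmPart (unitK (sfStep Lc j) (smStep 3 Lc j) (KTot (d := 3) (Lc ^ (j + m)) (Lc ^ j))))
      (2 * ((((Lc : ℝ) ^ m) ^ 8)⁻¹) * theta166Z 3 * (((Lc : ℝ) ^ 2)⁻¹) ^ m / (1 - ((Lc : ℝ) ^ 2)⁻¹)) (((Lc : ℝ) ^ 2)⁻¹)
      (kappaZ 3 / (Lc : ℝ) ^ m) := by
  have hθ := theta_lt_one (Lc := Lc) hLc
  refine decayCauchy_of_stepDecay (K := (fun j => mmPart (unitK (sfStep Lc j) (smStep 3 Lc j) (KTot (d := 3) (Lc ^ (j + m)) (Lc ^ j)))))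
    (fun j => mmJM_stepDecays m j) ?_ hθ.1 hθ.2
  have := T4Rate166StripDirect.C166_pos (3 + 1); unfold theta166Z; positivity

/-- **THE mm QUARTER OF X1m, ∃-PACKAGED** (`Lc ≥ 2`): explicit `C, δ > 0, cK, 0 ≤ θ < 1` with `UniformDecays` AND `DecayCauchy` for the mm parts of the
unit-rescaled (j, m)-resolvents — every constant Bałaban's (1.66) layer times the `j`-free unit factor `2/Lc^{8m}`. [our object] -/
theorem mmJM_binders (hLc : 2 ≤ Lc) (m : ℕ) :
    ∃ C δ cK θ : ℝ, 0 < δ ∧ 0 ≤ θ ∧ θ < 1 ∧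
      UniformDecays (fun j => mmPart (unitK (sfStep Lc j) (smStep 3 Lc j) (KTot (d := 3) (Lc ^ (j + m)) (Lc ^ j)))) C δ ∧
      DecayCauchy (fun j => mmPart (unitK (sfStep Lc j) (smStep 3 Lc j) (KTot (d := 3) (Lc ^ (j + m)) (Lc ^ j)))) cK θ δ := by
  have hθ := theta_lt_one (Lc := Lc) hLc
  have hL : (0 : ℝ) < (Lc : ℝ) ^ m := pow_pos (Nat.cast_pos.2 (Nat.pos_of_ne_zero (NeZero.ne Lc))) m
  exact ⟨_, _, _, _, div_pos (kappaZ_pos 3) hL, hθ.1, hθ.2, mmJM_uniformDecays m, mmJM_decayCauchy hLc m⟩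

end Decay

/-! ## §4 Entrywise convergence of the mm block to the perfect resolvent's mm block -/

section Limit

variable {Lc : ℕ} [NeZero Lc]

/-- [our object] The mm entries of the constructed limit `KPerf` ARE the constructed limits of the mm family's entries (the limit is entrywise). -/
theorem KPerf_inr_inr_eq_limMKerOf_mmJM (m : ℕ) (x' y' : Fin (3 + 1) → ℤ) (κ l : Fin (3 + 1)) :
    KPerf (d := 3) Lc (sfStep Lc) (smStep 3 Lc) m x' y' (Sum.inr κ) (Sum.inr l) =
      limMKerOf (fun j => mmPart (unitK (sfStep Lc j) (smStep 3 Lc j) (KTot (d := 3) (Lc ^ (j + m)) (Lc ^ j)))) x' y' (Sum.inr κ) (Sum.inr l) := by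
  unfold KPerf
  rw [limMKerOf_apply, limMKerOf_apply]
  rfl

/-- **THE mm QUARTER OF X1m, AS CONVERGENCE** (`Lc ≥ 2`): every mm entry of the unit-rescaled (j, m)-family converges, as `j → ∞`, to the corresponding mm
entry of the perfect `m`-fold resolvent `KPerf Lc (Lc^·) (Lc^{4·}) m` (`HessKerDressedLimit.tendsto_limMKerOf_of_decays` on the Cauchy data of §3). [our object] -/
theorem tendsto_mm_KTot_KPerf (hLc : 2 ≤ Lc) (m : ℕ) (x' y' : Fin (3 + 1) → ℤ) (κ l : Fin (3 + 1)) :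
    Tendsto (fun j => unitK (sfStep Lc j) (smStep 3 Lc j) (KTot (d := 3) (Lc ^ (j + m)) (Lc ^ j)) x' y' (Sum.inr κ) (Sum.inr l)) atTop
      (𝓝 (KPerf (d := 3) Lc (sfStep Lc) (smStep 3 Lc) m x' y' (Sum.inr κ) (Sum.inr l))) := by
  rw [KPerf_inr_inr_eq_limMKerOf_mmJM]
  exact tendsto_limMKerOf_of_decays (K := (fun j => mmPart (unitK (sfStep Lc j) (smStep 3 Lc j) (KTot (d := 3) (Lc ^ (j + m)) (Lc ^ j)))))
    (mmJM_decayCauchy hLc m) (theta_lt_one (Lc := Lc) hLc).2 x' y' (Sum.inr κ) (Sum.inr l)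

/-- **THE PERFECT RESOLVENT's mm BLOCK INHERITS THE UNIFORM DECAY** (`Lc ≥ 2`): `|KPerf … m x′ y′ (inr κ) (inr l)| ≤ (2/Lc^{8m})·c166Z 3 · e^{−(kappaZ 3/Lc^m)|x′−y′|₁}`
(`HessKerDressedLimit.decays_limMKerOf`). [our object] -/
theorem decays_mm_KPerf (hLc : 2 ≤ Lc) (m : ℕ) (x' y' : Fin (3 + 1) → ℤ) (κ l : Fin (3 + 1)) :
    |KPerf (d := 3) Lc (sfStep Lc) (smStep 3 Lc) m x' y' (Sum.inr κ) (Sum.inr l)| ≤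
      2 * ((((Lc : ℝ) ^ m) ^ 8)⁻¹) * c166Z 3 * Real.exp (-(kappaZ 3 / (Lc : ℝ) ^ m) * l1 (x' - y')) := by
  rw [KPerf_inr_inr_eq_limMKerOf_mmJM]
  exact decays_limMKerOf (mmJM_uniformDecays m) (mmJM_decayCauchy hLc m) (theta_lt_one (Lc := Lc) hLc).2 x' y' (Sum.inr κ) (Sum.inr l)

end Limit

end

end Summit.QuantumFields.BalabanUV.Beta.FP.ConvergenceJMMultiplier
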